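import Summits.Ventures.PercRepro.Defs
import Summits.Ventures.PercRepro.Conditioning
import Summits.Ventures.PercRepro.Graph
import Summits.Ventures.PercRepro.FlipConcavity

/-!
# The five-valued partition statistic of three marked vertices, and the pair-sum inequality (cross-validation twin)

For Bernoulli bond percolation on a finite multigraph `G` with arbitrary edge probabilities
`p ∈ [0,1]^E` and three marked vertices `a, b, c`, write

* `x  = P(a ↔ b ↔ c)`                       (all three in one open cluster),
* `y₁ = P({a,b} | c)`, `y₂ = P({a,c} | b)`, `y₃ = P({b,c} | a)`   (exactly one pair connected),
* `z  = P(a | b | c)`                        (pairwise disconnected).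

**Theorem (`MultiGraph.pair_sum_xval`; the landed statement is p5's `pair_sum`, this is its cross-validation twin).**  `y₁ y₂ + y₁ y₃ + y₂ y₃ ≤ x z`.

This is an instance of single-merge concavity (`smc_expect2_xval` of
`Summits.Ventures.PercRepro.FlipConcavity`) for the statistic `Φ = cell3` (the partition of
`{a,b,c}` induced by the open clusters, a value in the five-element type `Cell3`) and the
quadratic form `pairSumForm` with `A(top,bot) = A(bot,top) = 1/2`, `A(pairᵢ,pairⱼ) = -1/2`
(`i ≠ j`), all other entries `0`:

* opening one edge merges at most two open clusters, so the partition of `{a,b,c}` either stays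
  fixed or performs a *single merge* `bot → pairᵢ` or `pairᵢ → top` (`cell3_step`, from the
  contraction lemma `conn_update_true_iff`; never `bot → top`, never `pairᵢ → pairⱼ`);
* along all pairs of single merges the mixed second difference of `pairSumForm` is `≤ 0`
  (`pairSumForm_merge`, a finite check), and its diagonal vanishes.

Equality holds e.g. when one marked vertex separates the other two (the law then factorises), and
the inequality is strictly stronger than the sum of the three Ahlswede–Daykin instances
`(yᵢ + yⱼ) y_k ≤ x z` of the partition lattice, which only give `x z ≥ (2/3)(y₁y₂ + y₁y₃ + y₂y₃)`.
-/

namespace PercRepro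

open Finset

/-! ### The partition lattice of three marked vertices -/

/-- The five partitions of a three-element marked set `{a, b, c}`. -/
inductive Cell3
  /-- `a ↔ b ↔ c` -/
  | top
  /-- `{a, b} | c` -/
  | pab
  /-- `{a, c} | b` -/
  | pac
  /-- `{b, c} | a` -/
  | pbc
  /-- `a | b | c` -/
  | bot
  deriving DecidableEq

namespace Cell3

/-- Single merges in the partition lattice of `{a, b, c}`: `bot → pair` and `pair → top`
(the covering relation of the refinement order). -/
def Merge (s t : Cell3) : Prop :=
  (s = bot ∧ t = pab) ∨ (s = bot ∧ t = pac) ∨ (s = bot ∧ t = pbc) ∨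
    (s = pab ∧ t = top) ∨ (s = pac ∧ t = top) ∨ (s = pbc ∧ t = top)

/-- The pair-sum quadratic form: `A(top, bot) = A(bot, top) = 1/2`,
`A(pairᵢ, pairⱼ) = -1/2` for `i ≠ j`, all other entries `0`; so
`Σ_{s,t} A s t π_s π_t = π_top π_bot - (π_pab π_pac + π_pab π_pbc + π_pac π_pbc)`. -/
noncomputable def pairSumForm : Cell3 → Cell3 → ℝ
  | top, bot => 1 / 2
  | bot, top => 1 / 2
  | pab, pac => -(1 / 2)
  | pac, pab => -(1 / 2)
  | pab, pbc => -(1 / 2)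
  | pbc, pab => -(1 / 2)
  | pac, pbc => -(1 / 2)
  | pbc, pac => -(1 / 2)
  | _, _ => 0

/-- The diagonal of the pair-sum form vanishes. -/
theorem pairSumForm_self (s : Cell3) : pairSumForm s s = 0 := by
  cases s <;> rfl

/-- **The finite check**: along any two single merges `(s, t)`, `(s', t')` the mixed second
difference of the pair-sum form is nonpositive. -/
theorem pairSumForm_merge (s t s' t' : Cell3) (h : Merge s t) (h' : Merge s' t') :
    pairSumForm t t' - pairSumForm t s' - pairSumForm s t' + pairSumForm s s' ≤ 0 := by
  unfold Merge at h h'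
  rcases h with ⟨rfl, rfl⟩ | ⟨rfl, rfl⟩ | ⟨rfl, rfl⟩ | ⟨rfl, rfl⟩ | ⟨rfl, rfl⟩ | ⟨rfl, rfl⟩ <;>
    rcases h' with ⟨rfl, rfl⟩ | ⟨rfl, rfl⟩ | ⟨rfl, rfl⟩ | ⟨rfl, rfl⟩ | ⟨rfl, rfl⟩ | ⟨rfl, rfl⟩ <;>
    norm_num [pairSumForm]

/-- The indicator `[s = u]` of a value of `Cell3`, as a real number. -/
def ind (u s : Cell3) : ℝ := if s = u then 1 else 0

/-- The pair-sum form expanded in indicators. -/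
theorem pairSumForm_eq (s t : Cell3) :
    pairSumForm s t =
      1 / 2 * (ind top s * ind bot t + ind bot s * ind top t)
        - 1 / 2 * (ind pab s * ind pac t + ind pac s * ind pab t + ind pab s * ind pbc t
          + ind pbc s * ind pab t + ind pac s * ind pbc t + ind pbc s * ind pac t) := by
  cases s <;> cases t <;> simp +decide [pairSumForm, ind]

end Cell3

/-! ### The second moment of the pair-sum form -/

section Law

variable {E : Type*} [Fintype E] [DecidableEq E]

/-- The expectation of the indicator of `{Φ = u}` is the probability of that event. -/
theorem expect_ind (p : E → ℝ) (Φ : Config E → Cell3) (u : Cell3) :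
    expect p (fun ω => Cell3.ind u (Φ ω)) = prob p (Φ ⁻¹' {u}) := by
  rw [prob_eq_expect_indicator]
  congr 1
  funext ω
  by_cases h : Φ ω = u <;> simp [Cell3.ind, Set.indicator, h]

/-- The second moment of the pair-sum form of a `Cell3`-valued statistic `Φ`, in terms of the
law of `Φ`. -/
theorem expect2_pairSumForm (p : E → ℝ) (Φ : Config E → Cell3) :
    expect2 p p (fun ω ω' => Cell3.pairSumForm (Φ ω) (Φ ω'))
      = prob p (Φ ⁻¹' {Cell3.top}) * prob p (Φ ⁻¹' {Cell3.bot})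
        - (prob p (Φ ⁻¹' {Cell3.pab}) * prob p (Φ ⁻¹' {Cell3.pac})
          + prob p (Φ ⁻¹' {Cell3.pab}) * prob p (Φ ⁻¹' {Cell3.pbc})
          + prob p (Φ ⁻¹' {Cell3.pac}) * prob p (Φ ⁻¹' {Cell3.pbc})) := by
  simp_rw [Cell3.pairSumForm_eq]
  simp only [expect2_sub, expect2_add, expect2_const_mul, expect2_mul, expect_ind]
  ring

end Law

/-! ### The partition of three marked vertices induced by the open clusters -/

namespace MultiGraph

variable {V E : Type*} (G : MultiGraph V E) (a b c : V)

open Classical in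
/-- The partition of the marked vertices `a, b, c` induced by the open clusters of `ω`, as an
element of `Cell3` (classical, like `connPattern`). -/
noncomputable def cell3 (ω : Config E) : Cell3 :=
  if G.Conn ω a b then (if G.Conn ω b c then Cell3.top else Cell3.pab)
  else if G.Conn ω a c then Cell3.pac
  else if G.Conn ω b c then Cell3.pbc
  else Cell3.bot

variable {G a b c}

/-- `cell3 ω = top` iff `a ↔ b` and `b ↔ c`. -/
theorem cell3_eq_top_iff {ω : Config E} :
    G.cell3 a b c ω = Cell3.top ↔ G.Conn ω a b ∧ G.Conn ω b c := by
  unfold cell3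
  split_ifs <;> simp_all

/-- `cell3 ω = pab` iff `a ↔ b` and `b ↮ c`. -/
theorem cell3_eq_pab_iff {ω : Config E} :
    G.cell3 a b c ω = Cell3.pab ↔ G.Conn ω a b ∧ ¬ G.Conn ω b c := by
  unfold cell3
  split_ifs <;> simp_all

/-- `cell3 ω = pac` iff `a ↮ b` and `a ↔ c`. -/
theorem cell3_eq_pac_iff {ω : Config E} :
    G.cell3 a b c ω = Cell3.pac ↔ ¬ G.Conn ω a b ∧ G.Conn ω a c := by
  unfold cell3
  split_ifs <;> simp_all

/-- `cell3 ω = pbc` iff `a ↮ b`, `a ↮ c` and `b ↔ c`. -/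
theorem cell3_eq_pbc_iff {ω : Config E} :
    G.cell3 a b c ω = Cell3.pbc ↔ ¬ G.Conn ω a b ∧ ¬ G.Conn ω a c ∧ G.Conn ω b c := by
  unfold cell3
  split_ifs <;> simp_all

/-- `cell3 ω = bot` iff the three marked vertices are pairwise disconnected. -/
theorem cell3_eq_bot_iff {ω : Config E} :
    G.cell3 a b c ω = Cell3.bot ↔ ¬ G.Conn ω a b ∧ ¬ G.Conn ω a c ∧ ¬ G.Conn ω b c := by
  unfold cell3
  split_ifs <;> simp_all

/-! #### The fibres of `cell3` as connection / separation events -/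

/-- `{cell3 = top} = {a ↔ b} ∩ {b ↔ c}`. -/
theorem cell3_preimage_top :
    G.cell3 a b c ⁻¹' {Cell3.top} = G.connEvent a b ∩ G.connEvent b c := by
  ext ω
  simp only [Set.mem_preimage, Set.mem_singleton_iff, Set.mem_inter_iff, mem_connEvent]
  exact cell3_eq_top_iff

/-- `{cell3 = pab} = {a ↔ b} ∩ {a ↮ c}`. -/
theorem cell3_preimage_pab :
    G.cell3 a b c ⁻¹' {Cell3.pab} = G.connEvent a b ∩ G.sepEvent a c := by
  ext ω
  simp only [Set.mem_preimage, Set.mem_singleton_iff, Set.mem_inter_iff, mem_connEvent,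
    mem_sepEvent, cell3_eq_pab_iff]
  constructor
  · rintro ⟨hab, hbc⟩
    exact ⟨hab, fun hac => hbc (hab.symm.trans hac)⟩
  · rintro ⟨hab, hac⟩
    exact ⟨hab, fun hbc => hac (hab.trans hbc)⟩

/-- `{cell3 = pac} = {a ↔ c} ∩ {a ↮ b}`. -/
theorem cell3_preimage_pac :
    G.cell3 a b c ⁻¹' {Cell3.pac} = G.connEvent a c ∩ G.sepEvent a b := by
  ext ω
  simp only [Set.mem_preimage, Set.mem_singleton_iff, Set.mem_inter_iff, mem_connEvent,
    mem_sepEvent, cell3_eq_pac_iff]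
  exact and_comm

/-- `{cell3 = pbc} = {b ↔ c} ∩ {a ↮ b}`. -/
theorem cell3_preimage_pbc :
    G.cell3 a b c ⁻¹' {Cell3.pbc} = G.connEvent b c ∩ G.sepEvent a b := by
  ext ω
  simp only [Set.mem_preimage, Set.mem_singleton_iff, Set.mem_inter_iff, mem_connEvent,
    mem_sepEvent, cell3_eq_pbc_iff]
  constructor
  · rintro ⟨hab, _, hbc⟩
    exact ⟨hbc, hab⟩
  · rintro ⟨hbc, hab⟩
    exact ⟨hab, fun hac => hab (hac.trans hbc.symm), hbc⟩

/-- `{cell3 = bot} = {a ↮ b} ∩ {a ↮ c} ∩ {b ↮ c}`. -/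
theorem cell3_preimage_bot :
    G.cell3 a b c ⁻¹' {Cell3.bot} = G.sepEvent a b ∩ G.sepEvent a c ∩ G.sepEvent b c := by
  ext ω
  simp only [Set.mem_preimage, Set.mem_singleton_iff, Set.mem_inter_iff, mem_sepEvent,
    cell3_eq_bot_iff]
  tauto

/-! #### Opening one edge performs at most a single merge -/

section Step

variable [DecidableEq E]

/-- From the bottom partition, opening one edge cannot connect all three marked vertices: the
new connections `a ↔ b` and `b ↔ c` would both have to use the edge, which forces an old
connection between two of the marked vertices. -/
theorem not_conn_ab_and_bc_update {ω : Config E} {e : E}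
    (hab : ¬ G.Conn ω a b) (hac : ¬ G.Conn ω a c) (hbc : ¬ G.Conn ω b c) :
    ¬ (G.Conn (Function.update ω e true) a b ∧ G.Conn (Function.update ω e true) b c) := by
  rintro ⟨h1, h2⟩
  rw [conn_update_true_iff] at h1 h2
  rcases h1 with h1 | ⟨h1, h1'⟩ | ⟨h1, h1'⟩
  · exact hab h1
  · rcases h2 with h2 | ⟨h2, h2'⟩ | ⟨h2, h2'⟩
    · exact hbc h2
    · exact hab (h1.trans h2.symm)
    · exact hac (h1.trans h2')
  · rcases h2 with h2 | ⟨h2, h2'⟩ | ⟨h2, h2'⟩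
    · exact hbc h2
    · exact hac (h1.trans h2')
    · exact hab (h1.trans h2.symm)

/-- **Single-merge lemma.**  Opening the edge `e` in `ω` either leaves the partition of
`{a, b, c}` unchanged or performs a single merge (`bot → pairᵢ` or `pairᵢ → top`). -/
theorem cell3_step (ω : Config E) (e : E) :
    G.cell3 a b c ω = G.cell3 a b c (Function.update ω e true) ∨
      Cell3.Merge (G.cell3 a b c ω) (G.cell3 a b c (Function.update ω e true)) := by
  by_cases hab : G.Conn ω a b
  · by_cases hbc : G.Conn ω b c
    · left
      rw [cell3_eq_top_iff.2 ⟨hab, hbc⟩, cell3_eq_top_iff.2 ⟨hab.update_true, hbc.update_true⟩]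
    · have h0 := cell3_eq_pab_iff.2 ⟨hab, hbc⟩
      by_cases hbc1 : G.Conn (Function.update ω e true) b c
      · right
        rw [h0, cell3_eq_top_iff.2 ⟨hab.update_true, hbc1⟩]
        simp [Cell3.Merge]
      · left
        rw [h0, cell3_eq_pab_iff.2 ⟨hab.update_true, hbc1⟩]
  · by_cases hac : G.Conn ω a c
    · have h0 := cell3_eq_pac_iff.2 ⟨hab, hac⟩
      by_cases hab1 : G.Conn (Function.update ω e true) a b
      · right
        have hbc1 : G.Conn (Function.update ω e true) b c := hab1.symm.trans hac.update_true
        rw [h0, cell3_eq_top_iff.2 ⟨hab1, hbc1⟩]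
        simp [Cell3.Merge]
      · left
        rw [h0, cell3_eq_pac_iff.2 ⟨hab1, hac.update_true⟩]
    · by_cases hbc : G.Conn ω b c
      · have h0 := cell3_eq_pbc_iff.2 ⟨hab, hac, hbc⟩
        by_cases hab1 : G.Conn (Function.update ω e true) a b
        · right
          rw [h0, cell3_eq_top_iff.2 ⟨hab1, hbc.update_true⟩]
          simp [Cell3.Merge]
        · left
          have hac1 : ¬ G.Conn (Function.update ω e true) a c :=
            fun h => hab1 (h.trans hbc.update_true.symm)
          rw [h0, cell3_eq_pbc_iff.2 ⟨hab1, hac1, hbc.update_true⟩]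
      · have h0 := cell3_eq_bot_iff.2 ⟨hab, hac, hbc⟩
        by_cases hab1 : G.Conn (Function.update ω e true) a b
        · right
          have hbc1 : ¬ G.Conn (Function.update ω e true) b c :=
            fun h => not_conn_ab_and_bc_update hab hac hbc ⟨hab1, h⟩
          rw [h0, cell3_eq_pab_iff.2 ⟨hab1, hbc1⟩]
          simp [Cell3.Merge]
        · by_cases hac1 : G.Conn (Function.update ω e true) a c
          · right
            rw [h0, cell3_eq_pac_iff.2 ⟨hab1, hac1⟩]
            simp [Cell3.Merge]
          · by_cases hbc1 : G.Conn (Function.update ω e true) b c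
            · right
              rw [h0, cell3_eq_pbc_iff.2 ⟨hab1, hac1, hbc1⟩]
              simp [Cell3.Merge]
            · left
              rw [h0, cell3_eq_bot_iff.2 ⟨hab1, hac1, hbc1⟩]

/-- The single-merge lemma in the form used by `smc_expect2_xval`: between `ω[e := false]` and
`ω[e := true]` the partition of `{a, b, c}` is unchanged or performs a single merge. -/
theorem cell3_update_step (e : E) (ω : Config E) :
    G.cell3 a b c (Function.update ω e false) = G.cell3 a b c (Function.update ω e true) ∨
      Cell3.Merge (G.cell3 a b c (Function.update ω e false))
        (G.cell3 a b c (Function.update ω e true)) := by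
  have h := cell3_step (G := G) (a := a) (b := b) (c := c) (Function.update ω e false) e
  rwa [Function.update_idem] at h

end Step

/-! ### The pair-sum inequality -/

section Main

variable [Fintype E] [DecidableEq E]

/-- **The pair-sum inequality**, in terms of the law of `cell3`:
`P(pab) P(pac) + P(pab) P(pbc) + P(pac) P(pbc) ≤ P(top) P(bot)`. -/
theorem pair_sum_cell3_xval {p : E → ℝ} (hp : IsProb p) (G : MultiGraph V E) (a b c : V) :
    prob p (G.cell3 a b c ⁻¹' {Cell3.pab}) * prob p (G.cell3 a b c ⁻¹' {Cell3.pac})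
      + prob p (G.cell3 a b c ⁻¹' {Cell3.pab}) * prob p (G.cell3 a b c ⁻¹' {Cell3.pbc})
      + prob p (G.cell3 a b c ⁻¹' {Cell3.pac}) * prob p (G.cell3 a b c ⁻¹' {Cell3.pbc})
      ≤ prob p (G.cell3 a b c ⁻¹' {Cell3.top}) * prob p (G.cell3 a b c ⁻¹' {Cell3.bot}) := by
  have key := smc_expect2_xval hp (G.cell3 a b c) Cell3.pairSumForm Cell3.Merge
    (fun s => by rw [Cell3.pairSumForm_self]) (cell3_update_step (G := G) (a := a) (b := b) (c := c))
    Cell3.pairSumForm_merge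
  rw [expect2_pairSumForm] at key
  linarith

/-- **The pair-sum inequality** for three marked vertices `a, b, c` of a finite multigraph `G`
under Bernoulli bond percolation with edge probabilities `p ∈ [0,1]^E`:
`P({a,b}|c) P({a,c}|b) + P({a,b}|c) P({b,c}|a) + P({a,c}|b) P({b,c}|a) ≤ P(a↔b↔c) P(a|b|c)`,
where `{a,b}|c = {a ↔ b} ∩ {a ↮ c}`, `{a,c}|b = {a ↔ c} ∩ {a ↮ b}`, `{b,c}|a = {b ↔ c} ∩ {a ↮ b}`,
`a↔b↔c = {a ↔ b} ∩ {b ↔ c}` and `a|b|c = {a ↮ b} ∩ {a ↮ c} ∩ {b ↮ c}`. -/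
theorem pair_sum_xval {p : E → ℝ} (hp : IsProb p) (G : MultiGraph V E) (a b c : V) :
    prob p (G.connEvent a b ∩ G.sepEvent a c) * prob p (G.connEvent a c ∩ G.sepEvent a b)
      + prob p (G.connEvent a b ∩ G.sepEvent a c) * prob p (G.connEvent b c ∩ G.sepEvent a b)
      + prob p (G.connEvent a c ∩ G.sepEvent a b) * prob p (G.connEvent b c ∩ G.sepEvent a b)
      ≤ prob p (G.connEvent a b ∩ G.connEvent b c)
          * prob p (G.sepEvent a b ∩ G.sepEvent a c ∩ G.sepEvent b c) := by
  have h := pair_sum_cell3_xval hp G a b c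
  rwa [cell3_preimage_top, cell3_preimage_pab, cell3_preimage_pac, cell3_preimage_pbc,
    cell3_preimage_bot] at h

end Main

end MultiGraph

end PercRepro
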